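import Literature.AlgebraicGeometry.AbelianSchemes.AbelianSchemeHomDescentFlatSurjective
import Literature.AlgebraicGeometry.AbelianSchemes.AbelianSchemeDualIsogenyComp
import Literature.AlgebraicGeometry.AbelianSchemes.AbelianSchemeDualIsogenyHom
import Literature.AlgebraicGeometry.AbelianSchemes.AbelianSchemeQuotientMulNDescent
import Literature.AlgebraicGeometry.AbelianSchemes.AbelianSchemeOverHomOfReduced
import Literature.AlgebraicGeometry.AbelianSchemes.AbelianSchemeOverRingAction
import Mathlib.RingTheory.Ideal.Maps
import HarnessLib

/-!
# The twist homomorphism `λ_u : Q → Q̂` of an `𝒪`-scalar `u ∈ 𝔟·𝔟̄` on a quotient `q : A → Q` killing `A[𝔟]`: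
# `q ≫ λ_u ≫ q^∨ = ι(u) ≫ λ` ([MumfordAV1970] §7 Thm. 4, §15 Thm. 1, §23; [MilneCM2006] §7)

Topic `Literature/AlgebraicGeometry/AbelianSchemes`, namespace `Literature.AlgebraicGeometry.AbelianSchemes.AbelianSchemeOver`.  THEOREMS ONLY (no definition,
no named fact, no `instance`, no notation, no `sorry`).  Cell `hodgecm-mathlib` (D-0151), P6 «MOD», line L3 (socket `stub_FROB` → `stub_ROOF0`, `--supports
stmt-HodgeConjecture-24832`, count-neutral), RULING «DUAL-B̄» #7 organ **(S-u) «TWIST-HOM OF AN 𝒪-SCALAR»** (LA3-plan (g0) 05:11:57Z → A-p14 (g37)): the (r3₀)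
leg of the L3 roof wants `c̄ ≫ lamB ≫ c̄^∨ = λ ≫ [p]` EXACTLY, and the audit shows the polarisation `λ_Q` of the engine quotient must satisfy `q^*λ_Q = ι(u) ≫ λ`
for an 𝒪-SCALAR `u ∈ 𝔟·𝔟̄` (not an integer): this file constructs such a `λ_Q` for EVERY `u ∈ 𝔟·𝔟̄`, with no isotropy, no Mumford descent and no
integer factor.  HC_CM is proved only modulo the printed citations (2 remaining named inputs hLiu418 24832, h413 24833) until rung 0 closes; this file is generic
and changes no count.

THE MATHEMATICS.  Base `S` reduced and locally Noetherian (e.g. `Spec κ̄`); `A, Q` abelian `S`-schemes with dual pairs `D = (Â, 𝒫)`, `DQ = (Q̂, 𝒫_Q)` and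
their unit pins; an action `ι : 𝒪 → End(A)`, a ring map `c : 𝒪 → 𝒪` (complex conjugation) and a homomorphism `λ : A → Â` with the ROSATI ROW
`ι(c b) ≫ λ = λ ≫ ι(b)^∨` (the spine's (S6-R)); `q : A → Q` a flat surjective quasi-compact homomorphism KILLING `A[𝔟]` (`t ≫ q = 1 ⇒ ι(v) t = 1` for `v ∈ 𝔟`).
For `v ∈ 𝔟` the endomorphism `ι(v)` kills `Ker q`, so it DESCENDS: `ι(v) = q ≫ q′_v` with `q′_v : Q → A` a homomorphism ([MumfordAV1970] §7 Thm. 4; ★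
`exists_isMonHom_comp_eq_of_forall_comp_eq_one`).  Put `λ_{v,w} := q′_v ≫ λ ≫ (q′_w)^∨ : Q → Q̂`.  Then
`q ≫ λ_{v,w} ≫ q^∨ = ι(v) ≫ λ ≫ (q ≫ q′_w)^∨ = ι(v) ≫ λ ≫ ι(w)^∨ = ι(v) ≫ ι(c w) ≫ λ = ι(v · c w) ≫ λ` ((ψχ)^∨ = χ^∨ψ^∨ ★ `dualIsogenyOver_comp`; Rosati).
Products of such homomorphisms in the commutative group `Hom(Q, Q̂)` give `λ_u` for every `u = Σ vᵢ · c(wᵢ) ∈ 𝔟 · c(𝔟)` (`ι(u + u′) = ι(u)·ι(u′)`,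
`q ≫ (f·g) ≫ q^∨ = (q ≫ f ≫ q^∨)·(q ≫ g ≫ q^∨)` since `q^∨` is a homomorphism).

* §0 `isMonHom_one_hom`, `dualIsogenyOver_congr'` (private plumbing);
* §1 **`exists_twistHom_of_mem_of_mem`** — `v, w ∈ 𝔟 ⇒ ∃ ξ : Q → Q̂` homomorphism with `q ≫ ξ ≫ q^∨ = ι(v · c w) ≫ λ`;
* §2 `exists_twistHom_zero`, `exists_twistHom_add`, **`exists_twistHom_of_mem_mul_map`** — `u ∈ 𝔟 * 𝔟.map c ⇒ ∃ ξ, IsMonHom ξ ∧ q ≫ ξ ≫ q^∨ = ι(u) ≫ λ`;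
  **`exists_twistHom_of_mem_mul_map'`** — for `c` an involution the same in the `λ ≫ M` shape `q ≫ ξ ≫ q^∨ = λ ≫ ι(c u)^∨` (the `hq` binder of ★
  `RoofMiddleTransportAlongIso.conj_comp_inv_comp_lam_comp_dualIsogenyOver_ofIso` with `M := ι(c u)^∨`).

## References
* [MumfordAV1970] D. Mumford, *Abelian Varieties* (1970), §7 Thm. 4 (p. 72) (descent through a quotient), §15 Thm. 1 (p. 143) (the dual homomorphism),
  §20–§23 (Rosati involution, p. 189 ff.).
* [MilneCM2006] J. S. Milne, *Complex Multiplication* (2006), §7 «𝔞-multiplications» (Def. 7.19, Prop. 7.22, Rem. 7.23, pp. 58–59).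
* [MumfordFogartyKirwan1994] D. Mumford, J. Fogarty, F. Kirwan, *GIT*, 3rd ed. (1994), Ch. 6 §1 Cor. 6.4–6.5 (p. 117) (homomorphisms into a commutative
  abelian scheme form a group).
-/

set_option autoImplicit false

noncomputable section

universe u

open CategoryTheory CategoryTheory.Limits AlgebraicGeometry MonoidalCategory CartesianMonoidalCategory
open scoped MonObj

namespace Literature.AlgebraicGeometry.AbelianSchemes

namespace AbelianSchemeOver

/-! ## §0 Plumbing -/

section Plumbing

variable {S : Scheme.{u}} {A B : AbelianSchemeOver S}

/-- The unit of the group `Hom_S(B, A)` (the constant homomorphism `B → S →ε A`) is a homomorphism of group schemes.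
[cite: MumfordFogartyKirwan1994, Ch. 6 §1 Cor. 6.4–6.5 (p. 117)] -/
theorem isMonHom_one_hom : IsMonHom (1 : B.X ⟶ A.X) := by
  rw [Hom.one_def]; infer_instance

/-- `dualIsogenyOver` depends only on the morphism (rewriting under the instance argument).
[cite: MumfordAV1970, §15 Thm. 1 (p. 143)] -/
private theorem dualIsogenyOver_congr' {ψ₁ ψ₂ : A.X ⟶ B.X} [h₁ : IsMonHom ψ₁] [h₂ : IsMonHom ψ₂] (h : ψ₁ = ψ₂)
    (D' : A.DualPair) (DB : B.DualPair) : @DualPair.dualIsogenyOver S A B ψ₁ h₁ D' DB = @DualPair.dualIsogenyOver S A B ψ₂ h₂ D' DB := by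
  subst h; rfl

end Plumbing

/-! ## §1 The twist homomorphism of a product `v · c(w)`, `v, w ∈ 𝔟` -/

section Twist

variable {S : Scheme.{u}} [IsReduced S] [IsLocallyNoetherian S] {A Q : AbelianSchemeOver S}
  (D : A.DualPair) (DQ : Q.DualPair)
  (hD : Nonempty ((Scheme.Modules.pullback (DualPair.unitHatSlice D)).obj D.P ≅ SheafOfModules.unit _))
  (hDQ : Nonempty ((Scheme.Modules.pullback (DualPair.unitHatSlice DQ)).obj DQ.P ≅ SheafOfModules.unit _))
  {O : Type*} [CommRing O] (act : A.RingAction O) (c : O →+* O)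
  (lam : A.X ⟶ D.hat.X) [IsMonHom lam]
  (hros : ∀ b : O, haveI := act.isMonHom b; act.i (c b) ≫ lam = lam ≫ DualPair.dualIsogenyOver (act.i b) D D)
  (q : A.X ⟶ Q.X) [IsMonHom q] [Flat q.left] [Surjective q.left] [QuasiCompact q.left]
  {𝔟 : Ideal O} (hker : ∀ ⦃T : Over S⦄ (t : T ⟶ A.X), t ≫ q = 1 → ∀ v ∈ 𝔟, t ≫ act.i v = 1)

include hD hDQ hros hker in
/-- **THE TWIST HOMOMORPHISM OF `v · c(w)`** (`v, w ∈ 𝔟`): there is a homomorphism `ξ : Q → Q̂` with **`q ≫ ξ ≫ q^∨ = ι(v · c w) ≫ λ`** — namely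
`ξ := q′_v ≫ λ ≫ (q′_w)^∨` where `ι(v) = q ≫ q′_v`, `ι(w) = q ≫ q′_w` are the descents of `ι(v)`, `ι(w)` through `q` (they kill `Ker q ⊆ A[𝔟]`):
`q ≫ ξ ≫ q^∨ = ι(v) ≫ λ ≫ (q ≫ q′_w)^∨ = ι(v) ≫ λ ≫ ι(w)^∨ = ι(v) ≫ ι(c w) ≫ λ` (★ `dualIsogenyOver_comp`, Rosati row).
[cite: MumfordAV1970, §7 Thm. 4 (p. 72) and §15 Thm. 1 (p. 143)] [cite: MilneCM2006, §7 (Def. 7.19, Prop. 7.22, Rem. 7.23, pp. 58–59)] -/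
theorem exists_twistHom_of_mem_of_mem {v w : O} (hv : v ∈ 𝔟) (hw : w ∈ 𝔟) :
    ∃ ξ : Q.X ⟶ DQ.hat.X, IsMonHom ξ ∧ q ≫ ξ ≫ DualPair.dualIsogenyOver q D DQ = act.i (v * c w) ≫ lam := by
  haveI := act.isMonHom v
  haveI := act.isMonHom w
  haveI := act.isMonHom (c w)
  haveI := act.isMonHom (v * c w)
  -- descend `ι(v)`, `ι(w)` through `q`
  obtain ⟨qv, hqv, hqv_eq, -⟩ := A.exists_isMonHom_comp_eq_of_forall_comp_eq_one q (act.i v) (fun T t ht => hker t ht v hv)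
  obtain ⟨qw, hqw, hqw_eq, -⟩ := A.exists_isMonHom_comp_eq_of_forall_comp_eq_one q (act.i w) (fun T t ht => hker t ht w hw)
  haveI := hqv
  haveI := hqw
  haveI : IsMonHom (DualPair.dualIsogenyOver qw DQ D) := DualPair.isMonHom_dualIsogenyOver qw DQ D hD hDQ
  haveI : IsMonHom (DualPair.dualIsogenyOver q D DQ) := DualPair.isMonHom_dualIsogenyOver q D DQ hDQ hD
  refine ⟨qv ≫ lam ≫ DualPair.dualIsogenyOver qw DQ D, inferInstance, ?_⟩
  -- `q ≫ q′_v ≫ λ ≫ q′_w^∨ ≫ q^∨ = ι(v) ≫ λ ≫ (q ≫ q′_w)^∨`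
  have h1 : q ≫ (qv ≫ lam ≫ DualPair.dualIsogenyOver qw DQ D) ≫ DualPair.dualIsogenyOver q D DQ =
      act.i v ≫ lam ≫ DualPair.dualIsogenyOver (q ≫ qw) D D := by
    rw [DualPair.dualIsogenyOver_comp q qw D DQ D, ← hqv_eq]
    simp only [Category.assoc]
  rw [h1, dualIsogenyOver_congr' hqw_eq D D, ← hros w, ← Category.assoc, ← act.i_mul, mul_comm]

/-! ## §2 Every `u ∈ 𝔟 · c(𝔟)` -/

omit [Flat q.left] [Surjective q.left] [QuasiCompact q.left] in
include hD hDQ in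
/-- `u = 0`: the trivial homomorphism (`ι(0) = 1`). [cite: MumfordFogartyKirwan1994, Ch. 6 §1 Cor. 6.4–6.5 (p. 117)] -/
theorem exists_twistHom_zero :
    ∃ ξ : Q.X ⟶ DQ.hat.X, IsMonHom ξ ∧ q ≫ ξ ≫ DualPair.dualIsogenyOver q D DQ = act.i 0 ≫ lam := by
  haveI : IsMonHom (DualPair.dualIsogenyOver q D DQ) := DualPair.isMonHom_dualIsogenyOver q D DQ hDQ hD
  refine ⟨1, isMonHom_one_hom, ?_⟩
  rw [act.i_zero, MonObj.one_comp, MonObj.comp_one, MonObj.one_comp]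

omit [Flat q.left] [Surjective q.left] [QuasiCompact q.left] in
include hD hDQ in
/-- Additivity in `u`: twist homomorphisms for `u`, `u′` multiply (in the commutative group `Hom(Q, Q̂)`) to one for `u + u′`
(`ι(u + u′) = ι(u)·ι(u′)`; `q ≫ (f·g) ≫ q^∨ = (q ≫ f ≫ q^∨)·(q ≫ g ≫ q^∨)` as `q^∨` and `λ` are homomorphisms).
[cite: MumfordFogartyKirwan1994, Ch. 6 §1 Cor. 6.4–6.5 (p. 117)] [cite: MumfordAV1970, §15 Thm. 1 (p. 143)] -/
theorem exists_twistHom_add {u u' : O}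
    (hu : ∃ ξ : Q.X ⟶ DQ.hat.X, IsMonHom ξ ∧ q ≫ ξ ≫ DualPair.dualIsogenyOver q D DQ = act.i u ≫ lam)
    (hu' : ∃ ξ : Q.X ⟶ DQ.hat.X, IsMonHom ξ ∧ q ≫ ξ ≫ DualPair.dualIsogenyOver q D DQ = act.i u' ≫ lam) :
    ∃ ξ : Q.X ⟶ DQ.hat.X, IsMonHom ξ ∧ q ≫ ξ ≫ DualPair.dualIsogenyOver q D DQ = act.i (u + u') ≫ lam := by
  haveI : IsCommMonObj DQ.hat.X := DQ.hat.isCommMonObj_of_isReduced_base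
  haveI : IsMonHom (DualPair.dualIsogenyOver q D DQ) := DualPair.isMonHom_dualIsogenyOver q D DQ hDQ hD
  obtain ⟨ξ, hξ, hξ_eq⟩ := hu
  obtain ⟨ξ', hξ', hξ'_eq⟩ := hu'
  haveI := hξ
  haveI := hξ'
  refine ⟨ξ * ξ', DQ.hat.isMonHom_mul ξ ξ', ?_⟩
  have hmul : (ξ * ξ') ≫ DualPair.dualIsogenyOver q D DQ = (ξ ≫ DualPair.dualIsogenyOver q D DQ) * (ξ' ≫ DualPair.dualIsogenyOver q D DQ) :=
    (IsMonHom.monoidHom (DualPair.dualIsogenyOver q D DQ) _).map_mul ξ ξ'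
  have hlam : (act.i u * act.i u') ≫ lam = (act.i u ≫ lam) * (act.i u' ≫ lam) := (IsMonHom.monoidHom lam _).map_mul _ _
  calc q ≫ (ξ * ξ') ≫ DualPair.dualIsogenyOver q D DQ
        = q ≫ ((ξ ≫ DualPair.dualIsogenyOver q D DQ) * (ξ' ≫ DualPair.dualIsogenyOver q D DQ)) := by rw [hmul]
    _ = (q ≫ ξ ≫ DualPair.dualIsogenyOver q D DQ) * (q ≫ ξ' ≫ DualPair.dualIsogenyOver q D DQ) := MonObj.comp_mul _ _ _
    _ = (act.i u ≫ lam) * (act.i u' ≫ lam) := by rw [hξ_eq, hξ'_eq]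
    _ = act.i (u + u') ≫ lam := by rw [act.i_add, hlam]

include hD hDQ hros hker in
/-- **THE TWIST HOMOMORPHISM OF AN 𝒪-SCALAR `u ∈ 𝔟 · c(𝔟)`**: there is a homomorphism `ξ : Q → Q̂` with **`q ≫ ξ ≫ q^∨ = ι(u) ≫ λ`** — `u` is a sum of
products `m · Σ rᵢ c(wᵢ)` (`m, wᵢ ∈ 𝔟`), each `m rᵢ · c(wᵢ)` has a twist homomorphism (§1), and twist homomorphisms add (`exists_twistHom_add`;
Mathlib `Submodule.mul_induction_on` ∕ `Submodule.span_induction`).  No isotropy, no Mumford descent, no integer factor.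
[cite: MumfordAV1970, §7 Thm. 4 (p. 72) and §15 Thm. 1 (p. 143)] [cite: MilneCM2006, §7 (Def. 7.19, Prop. 7.22, Rem. 7.23, pp. 58–59)] -/
theorem exists_twistHom_of_mem_mul_map {u : O} (hu : u ∈ 𝔟 * 𝔟.map c) :
    ∃ ξ : Q.X ⟶ DQ.hat.X, IsMonHom ξ ∧ q ≫ ξ ≫ DualPair.dualIsogenyOver q D DQ = act.i u ≫ lam := by
  -- inner induction over `𝔟.map c = span (c '' 𝔟)`, uniformly in the left factor `m ∈ 𝔟`
  have inner : ∀ n ∈ 𝔟.map c, ∀ m ∈ 𝔟,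
      ∃ ξ : Q.X ⟶ DQ.hat.X, IsMonHom ξ ∧ q ≫ ξ ≫ DualPair.dualIsogenyOver q D DQ = act.i (m * n) ≫ lam := by
    intro n hn
    have hn' : n ∈ Submodule.span O (c '' (𝔟 : Set O)) := hn
    refine Submodule.span_induction (p := fun n _ => ∀ m ∈ 𝔟,
      ∃ ξ : Q.X ⟶ DQ.hat.X, IsMonHom ξ ∧ q ≫ ξ ≫ DualPair.dualIsogenyOver q D DQ = act.i (m * n) ≫ lam) ?_ ?_ ?_ ?_ hn'
    · rintro _ ⟨w, hw, rfl⟩ m hm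
      exact exists_twistHom_of_mem_of_mem D DQ hD hDQ act c lam hros q hker hm hw
    · intro m _
      rw [mul_zero]
      exact exists_twistHom_zero D DQ hD hDQ act lam q
    · intro x y _ _ hx hy m hm
      rw [mul_add]
      exact exists_twistHom_add D DQ hD hDQ act lam q (hx m hm) (hy m hm)
    · intro r x _ hx m hm
      rw [smul_eq_mul, ← mul_assoc]
      exact hx (m * r) (Ideal.mul_mem_right r 𝔟 hm)
  exact Submodule.mul_induction_on hu (fun m hm n hn => inner n hn m hm)
    (fun x y hx hy => exists_twistHom_add D DQ hD hDQ act lam q hx hy)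

include hD hDQ hros hker in
/-- **The same in the `λ ≫ M` shape** (`c` an involution, e.g. complex conjugation on `𝓞 F`): `q ≫ ξ ≫ q^∨ = λ ≫ ι(c u)^∨` — since
`ι(u) ≫ λ = ι(c (c u)) ≫ λ = λ ≫ ι(c u)^∨` by the Rosati row.  This is the binder `hq : q ≫ λ_Q ≫ q^∨ = λ ≫ M` of ★
`RoofMiddleTransportAlongIso.conj_comp_inv_comp_lam_comp_dualIsogenyOver_ofIso` with `M := ι(c u)^∨`.
[cite: MumfordAV1970, §15 Thm. 1 (p. 143) and §20–§23 (p. 189 ff.)] [cite: MilneCM2006, §7 (Def. 7.19, Prop. 7.22, Rem. 7.23, pp. 58–59)] -/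
theorem exists_twistHom_of_mem_mul_map' (hcc : ∀ x : O, c (c x) = x) {u : O} (hu : u ∈ 𝔟 * 𝔟.map c) :
    ∃ ξ : Q.X ⟶ DQ.hat.X, IsMonHom ξ ∧
      q ≫ ξ ≫ DualPair.dualIsogenyOver q D DQ = lam ≫ (haveI := act.isMonHom (c u); DualPair.dualIsogenyOver (act.i (c u)) D D) := by
  obtain ⟨ξ, hξ, hξ_eq⟩ := exists_twistHom_of_mem_mul_map D DQ hD hDQ act c lam hros q hker hu
  refine ⟨ξ, hξ, ?_⟩
  rw [hξ_eq, ← hros (c u), hcc]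

end Twist

end AbelianSchemeOver

end Literature.AlgebraicGeometry.AbelianSchemes

end
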